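import Summits.KontsevichZagierPeriods.KontsevichZagierPeriods.Theses.K2SymbolChains

/-!
# Route K2SymbolChains — `Assembly`: the route's items imply the summit statement

Problem `KontsevichZagierPeriods`, route `K2SymbolChains`, item stmt-KontsevichZagierPeriods-5205
(`Assembly`, assembly, rank 1). The route declaration `Assembly` is the curried implication
`JensenMove → SteinbergChain → SymbolKernel → KontsevichZagierPeriods`: the two symbol-engine cruxes
of the route ("Jensen is a move", "Steinberg is a chain", both realised inside `KZ.relations`)
together with the target `SymbolKernel` (every subgroup `R ≥ KZ.relations` closed under all
`JensenMove` and all `SteinbergChain` instances contains `ker KZ.eval`) imply the summit statement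
`KontsevichZagierPeriods` (two rational-shape integral representations with equal values are
equivalent under Kontsevich–Zagier's moves). Proof: specialise `SymbolKernel` at
`R := KZ.relations` (`le_rfl`; the two closure hypotheses are then literally `JensenMove` and
`SteinbergChain`) to get the kernel form `∀ c, KZ.eval c = 0 → c ∈ KZ.relations` of Conjecture 1,
and for representations `r, r'` with equal values `KZ.eval ([r] - [r']) = 0`, so `[r] - [r']` is a
relation. This is literally the type of the route's kernel-checked deciding theorem
`K2SymbolChains.closes`, so the item is settled by citing it.

Sources: M. Kontsevich, D. Zagier, *Periods* (2001), §1.2 (Conjecture 1 and its kernel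
reformulation); A. Huber, S. Müller-Stach, *Periods and Nori Motives* (2017), §13.1. Deliberately
NOT here: any claim about the three hypotheses themselves (two cruxes and a summit-strength
target) — the result is the implication only (unconditional as an implication).
-/

namespace Summit.KontsevichZagierPeriods.K2SymbolChains

/-- Settles stmt-KontsevichZagierPeriods-5205: the route declaration `K2SymbolChains.Assembly`
(`JensenMove → SteinbergChain → SymbolKernel → KontsevichZagierPeriods`) holds — after unfolding it
is exactly the route's kernel-checked deciding theorem `K2SymbolChains.closes` (specialise
`SymbolKernel` at `R := KZ.relations`, whose closure hypotheses are the two cruxes, to get the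
kernel form of Conjecture 1; equal values of `r, r'` give `KZ.eval ([r] - [r']) = 0`, hence
`[r] - [r'] ∈ KZ.relations`). [Kontsevich–Zagier 2001, §1.2] [folklore] -/
theorem assembly_proof :
    Summit.KontsevichZagierPeriods.KontsevichZagierPeriods.Theses.K2SymbolChains.Assembly := by
  unfold Summit.KontsevichZagierPeriods.KontsevichZagierPeriods.Theses.K2SymbolChains.Assembly
  exact Summit.KontsevichZagierPeriods.KontsevichZagierPeriods.Theses.K2SymbolChains.closes

end Summit.KontsevichZagierPeriods.K2SymbolChains
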